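import Summits.ValiantsHypothesis.ValiantsHypothesis.Theses.ProjectionStability
import Literature.Computability.AlgebraicComplexity.LandsbergRessayreProofs
import Literature.Computability.AlgebraicComplexity.GrenetEquivariant
import Summits.ValiantsHypothesis.ValiantsHypothesis.Theorems.ProjectionStabilityOptStepStubGrenetProjection
import Summits.ValiantsHypothesis.ValiantsHypothesis.Theorems.ProjectionStabilityOptStepStubGrenetLeftEquivariant
import Summits.ValiantsHypothesis.ValiantsHypothesis.Theorems.ProjectionStabilityOptStepStubGrenetGaugeRigid
import Summits.ValiantsHypothesis.ValiantsHypothesis.Theorems.ProjectionStabilityOptStepStubHalfEqTransportGauge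
import Summits.ValiantsHypothesis.ValiantsHypothesis.Theorems.ProjectionStabilityOptStepStubHalfEqTransportSymm
import Summits.ValiantsHypothesis.ValiantsHypothesis.Theorems.ProjectionStabilityOptStepStubHalfEqOfUniq
import Summits.ValiantsHypothesis.ValiantsHypothesis.Theorems.ProjectionStabilityOptStepStubEvalPermPerPoly
import Summits.ValiantsHypothesis.ValiantsHypothesis.Theorems.ProjectionStabilityOptStepStubCoverCount
import Summits.ValiantsHypothesis.ValiantsHypothesis.Theorems.ProjectionStabilityOptStepStubTwoSidedTorusLower

/-!
# Line `Sketch` (symmetry ⇒ Landsberg–Ressayre-type count) — skeleton v3 for crux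
# `ProjectionStability.OptStep` (stmt-ValiantsHypothesis-17835)

Crux (by name): `Summit.ValiantsHypothesis.ValiantsHypothesis.Theses.ProjectionStability.OptStep` =
`∀ n ≥ 3, Opt n → Uniq n → Opt (n+1)` with `Opt n := 2ⁿ − 1 ≤ pdc(per_n)`
(`pdc = detProjectionComplexity`, Valiant's projection model: every cell a variable or a constant) and
`Uniq n :=` any two optimal projections of `per_n` are related by constant gauge `GL × GL`, a
realised symmetry `γ ∈ permSymmetrySubst ℂ n` of `per_n`, and possibly matrix transposition.

## History
* v1/v2 (lead c0, cycle 1): transfer `OptStep ⇐ SymStep ∧ LR17 Thm 2.8`; infrastructure stubs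
  S2 `stub_grenetProjection`, S3 `stub_grenet_leftEquivariant`, S4 `stub_grenet_gaugeRigid`,
  S5 `stub_halfEq_transport_gauge`, S6 `stub_halfEq_transport_symm`, S8 `stub_halfEq_of_uniq`
  LANDED (p147445, p148116, p149081, p146826, p147109, p149229); the bet S7 `stub_symStep`
  ("EVERY optimal projection of `per_{n+1}` is left-monomial half-equivariant") was isolated as
  crux-sized — it is strictly STRONGER than the crux.
* v3 (lead c1, cycle 2, this file): the bet is WEAKENED to its weakest useful form and the count is
  STRENGTHENED so that torus symmetry alone suffices:
  - K2 `stub_twoSidedTorus_lower` (NEW THEOREM, held by the lead; LANDED p155768 with helpers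
    p152977, p153399, p154544 and worker stubs H1 p152657, H2 p152940; corollary
    `edc_{T²}(per_m) = 2^m − 1` in `…TwoSidedTorusEdc.lean`): every affine determinantal
    representation of `per_m` (`m ≥ 3`) over `ℂ` that is equivariant (exact lifts) for the
    TWO-SIDED TORUS `x ↦ diag(d) x diag(e)` has size `≥ 2^m − 1` — the lower half of
    `edc_{T²}(per_m) = 2^m − 1` (upper half in the tree: `Grenet.hasEquivariantDetRepr_perPoly_twoSidedTorus`).
    LR17 Thm 2.8 (tree: `lr_left_equivariant_lower_holds`) needs the left torus AND all row
    permutations; K2 needs both tori and NO permutation — exactly the symmetry a degeneration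
    (1-parameter subgroup limit inside the gauge × torus group) can deliver (cards
    `toric-degeneration-graded-count`, `toric-exposure-bigrading`: K2 = their `GradedBound` /
    `BigradedBound` in full, affine, generality).  Proof plan: regularity (von zur Gathen, tree) →
    the tree's LR §6 machinery (canonical subspaces, one generic lifted torus element
    `diag(p) ⊗ diag(q)`, `2m` distinct primes) ported to non-prime multipliers and run on the `m!`
    restricted pencils `Λ + Σ_k y_k A_{k,π k}` (injective member `A(P_π)`, `per(P_π) = 1`: H1) →
    top exponent `𝟙` by a transposition-swap argument across `π` → weights of every support size
    (chain) → labels `(S, π S)` counted by double counting over `𝔖_m` (H2: `≥ C(m,s)` per level) →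
    `2^m − 2` distinct non-top weights + the top weight.
  - H1 `stub_eval_perm_perPoly`, H2 `stub_coverCount`: self-contained helper stubs of K2 (workers).
  - BET `stub_symOrTorusStep`: `Opt n → Uniq n →` SOME optimal-size affine determinantal
    representation of `per_{n+1}` is left-monomial-equivariant OR two-sided-torus-equivariant.
    HONEST SCOPE (`symOrTorusStep_iff_optStep`, proved below from K2 + LR + Grenet + S2 + S3): the
    bet is EQUIVALENT to the crux — a symmetry line cannot do better than re-express `Opt (n+1)` as
    "symmetry at optimal size"; the cards' mechanisms (patching / degeneration) are ways to PRODUCE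
    that symmetry from `Opt n ∧ Uniq n`, and remain the open research content.
  Composition `OptStep_of`: bet → (left case: LR17 Thm 2.8) ∨ (torus case: K2).

## Disproof.lean used (rev 1, cdisprove cycle 1, read 2026-08-17T09:30Z)
No kill; no `_false_without_` lemma (every mutation open or true); refutation only at `n = 3` modulo
`UniqBase ∧ (≤ 14 × 14 projection of per₄)`.  Honoured: the bet consumes `Opt n`, `Uniq n`; K2/LR are
insensitive to constants; v3's bet is weaker than v2's S7, so every S7-witness test in (d) still applies.
-/

set_option linter.unusedVariables false
set_option linter.dupNamespace false

namespace Summit.ValiantsHypothesis.ValiantsHypothesis.Cruxes.OptStep.Sketch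

open MvPolynomial
open scoped BigOperators Matrix
open Literature.Computability.AlgebraicComplexity

noncomputable section

/-! ## S1 (proved): an optimal projection matrix exists -/

/-- **S1.** `pdc(per_k)` is attained by an honest matrix: there is a `pdc × pdc` matrix whose cells
are variables or constants and whose determinant is `per_k`. -/
theorem exists_optimalProjection (k : ℕ) :
    ∃ B : Matrix (Fin (detProjectionComplexity (perPoly (Fin k) ℂ)))
        (Fin (detProjectionComplexity (perPoly (Fin k) ℂ))) (MvPolynomial (Fin k × Fin k) ℂ),
      (∀ i j, (∃ v, B i j = X v) ∨ ∃ c, B i j = C c) ∧ B.det = perPoly (Fin k) ℂ := by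
  obtain ⟨a, ha, hdet⟩ := isDetProjection_detProjectionComplexity (perPoly (Fin k) ℂ)
  refine ⟨Matrix.of fun i j => a (i, j), fun i j => ha (i, j), ?_⟩
  rw [detPoly, AlgHom.map_det] at hdet
  refine Eq.trans ?_ hdet.symm
  congr 1
  ext i j
  simp [Matrix.mvPolynomialX]

/-! ## Landed infrastructure of v2 (S2–S6, S8; no `sorry`) -/

/-- **S2 — Grenet's representation is a strict projection** (landed p147445). -/
theorem stub_grenetProjection :
    ∀ n : ℕ, 1 ≤ n → IsDetProjection (perPoly (Fin n) ℂ) (2 ^ n - 1) :=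
  Summit.ValiantsHypothesis.ValiantsHypothesis.Theorems.ProjectionStabilityOptStep.GrenetProjection.stub_grenetProjection

/-- **S3 — Grenet's matrix is left-monomial-equivariant with exact lifts** (landed p148116). -/
theorem stub_grenet_leftEquivariant :
    ∀ (n : ℕ), n ≠ 0 → ∀ (N : ℕ) (hN : 2 ^ n = N + 1) (e : Finset (Fin n) ≃ Fin (N + 1)),
      IsEquivariantDetRepr (leftMonomialSubst ℂ n) (perPoly (Fin n) ℂ) (Grenet.repr ℂ n e) :=
  Summit.ValiantsHypothesis.ValiantsHypothesis.Theorems.ProjectionStabilityOptStep.GrenetLeftEquivariant.stub_grenet_leftEquivariant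

/-- **S4 — gauge rigidity of Grenet's matrix** (landed p149081). -/
theorem stub_grenet_gaugeRigid :
    ∀ (n N : ℕ) (hN : 2 ^ n = N + 1) (e : Finset (Fin n) ≃ Fin (N + 1)) (P Q : Matrix (Fin N) (Fin N) ℂ),
      P.map C * Grenet.repr ℂ n e = Grenet.repr ℂ n e * Q.map C → ∃ c : ℂ, P = c • 1 ∧ Q = c • 1 :=
  Summit.ValiantsHypothesis.ValiantsHypothesis.Theorems.ProjectionStabilityOptStep.GrenetGaugeRigid.stub_grenet_gaugeRigid

/-- **S5 — transport of half-equivariance along gauge / transposition** (landed p146826). -/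
theorem stub_halfEq_transport_gauge :
    ∀ (k m : ℕ) (A B : Matrix (Fin m) (Fin m) (MvPolynomial (Fin k × Fin k) ℂ)) (P Q : GL (Fin m) ℂ),
      (IsEquivariantDetRepr (leftMonomialSubst ℂ k) (perPoly (Fin k) ℂ) A ∨
        IsEquivariantDetRepr (leftMonomialSubst ℂ k) (perPoly (Fin k) ℂ) (A.map (rename Prod.swap))) →
      (B = (P : Matrix (Fin m) (Fin m) ℂ).map C * A * (Q : Matrix (Fin m) (Fin m) ℂ).map C ∨
        B = (P : Matrix (Fin m) (Fin m) ℂ).map C * A.transpose * (Q : Matrix (Fin m) (Fin m) ℂ).map C) →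
      B.det = perPoly (Fin k) ℂ →
      (IsEquivariantDetRepr (leftMonomialSubst ℂ k) (perPoly (Fin k) ℂ) B ∨
        IsEquivariantDetRepr (leftMonomialSubst ℂ k) (perPoly (Fin k) ℂ) (B.map (rename Prod.swap))) :=
  Summit.ValiantsHypothesis.ValiantsHypothesis.Theorems.ProjectionStabilityOptStep.TransportGauge.stub_halfEq_transport_gauge

/-- **S6 — transport of half-equivariance along `permSymmetrySubst`** (landed p147109). -/
theorem stub_halfEq_transport_symm :
    ∀ (k m : ℕ) (A : Matrix (Fin m) (Fin m) (MvPolynomial (Fin k × Fin k) ℂ)) (γ : GL (Fin k × Fin k) ℂ),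
      γ ∈ permSymmetrySubst ℂ k →
      (IsEquivariantDetRepr (leftMonomialSubst ℂ k) (perPoly (Fin k) ℂ) A ∨
        IsEquivariantDetRepr (leftMonomialSubst ℂ k) (perPoly (Fin k) ℂ) (A.map (rename Prod.swap))) →
      (Matrix.linSubstEntries γ A).det = perPoly (Fin k) ℂ →
      (IsEquivariantDetRepr (leftMonomialSubst ℂ k) (perPoly (Fin k) ℂ) (Matrix.linSubstEntries γ A) ∨
        IsEquivariantDetRepr (leftMonomialSubst ℂ k) (perPoly (Fin k) ℂ)
          ((Matrix.linSubstEntries γ A).map (rename Prod.swap))) :=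
  Summit.ValiantsHypothesis.ValiantsHypothesis.Theorems.ProjectionStabilityOptStep.TransportSymm.stub_halfEq_transport_symm

/-- **S8 — level-`n` uniqueness forces half-symmetry** (landed p149229). -/
theorem stub_halfEq_of_uniq :
    ∀ n : ℕ, 1 ≤ n → 2 ^ n - 1 ≤ detProjectionComplexity (perPoly (Fin n) ℂ) →
      (∀ A B : Matrix (Fin (detProjectionComplexity (perPoly (Fin n) ℂ)))
          (Fin (detProjectionComplexity (perPoly (Fin n) ℂ))) (MvPolynomial (Fin n × Fin n) ℂ),
        (∀ i j, (∃ v, A i j = MvPolynomial.X v) ∨ ∃ c, A i j = MvPolynomial.C c) →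
        (∀ i j, (∃ v, B i j = MvPolynomial.X v) ∨ ∃ c, B i j = MvPolynomial.C c) →
        A.det = perPoly (Fin n) ℂ → B.det = perPoly (Fin n) ℂ →
        ∃ (P Q : GL (Fin (detProjectionComplexity (perPoly (Fin n) ℂ))) ℂ) (γ : GL (Fin n × Fin n) ℂ),
          γ ∈ permSymmetrySubst ℂ n ∧
          (B = (P : Matrix _ _ ℂ).map MvPolynomial.C * Matrix.linSubstEntries γ A * (Q : Matrix _ _ ℂ).map MvPolynomial.C ∨
            B = (P : Matrix _ _ ℂ).map MvPolynomial.C * (Matrix.linSubstEntries γ A).transpose *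
              (Q : Matrix _ _ ℂ).map MvPolynomial.C)) →
      ∀ D : Matrix (Fin (detProjectionComplexity (perPoly (Fin n) ℂ)))
          (Fin (detProjectionComplexity (perPoly (Fin n) ℂ))) (MvPolynomial (Fin n × Fin n) ℂ),
        (∀ i j, (∃ v, D i j = X v) ∨ ∃ c, D i j = C c) → D.det = perPoly (Fin n) ℂ →
        IsEquivariantDetRepr (leftMonomialSubst ℂ n) (perPoly (Fin n) ℂ) D ∨
          IsEquivariantDetRepr (leftMonomialSubst ℂ n) (perPoly (Fin n) ℂ) (D.map (rename Prod.swap)) :=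
  Summit.ValiantsHypothesis.ValiantsHypothesis.Theorems.ProjectionStabilityOptStep.HalfEqOfUniq.stub_halfEq_of_uniq

/-! ## Registered stubs of v3 (after cycle 2 the ONLY `sorry` left is the bet `stub_symOrTorusStep`) -/

/-- **H1 — the permanent of a permutation matrix is `1`**: evaluating `per_m` at the `0/1` matrix
of `π` gives `1` (the invertible member `A(P_π)` of the `π`-restricted pencil in K2's proof).
Size S. [folklore; Mathlib `Matrix.permanent_permute_rows`, `Matrix.permanent_one`, tree `eval_perPoly`] -/
theorem stub_eval_perm_perPoly :
    ∀ (m : ℕ) (π : Equiv.Perm (Fin m)),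
      MvPolynomial.eval (fun p : Fin m × Fin m => if p.2 = π p.1 then (1 : ℂ) else 0)
        (perPoly (Fin m) ℂ) = 1 :=
  -- H1 LANDED (wave 1, p152657): Theorems/ProjectionStabilityOptStepStubEvalPermPerPoly.lean
  Summit.ValiantsHypothesis.ValiantsHypothesis.Theorems.ProjectionStabilityOptStep.EvalPermPerPoly.stub_eval_perm_perPoly

/-- **H2 — the covering count** (double counting over `𝔖_m`): if to every permutation `π` of
`Fin m` is attached an exponent vector `lab π : Fin m → ℕ` with exactly `s` non-zero entries, then
the pairs `(lab π, lab π ∘ π⁻¹)` ("rows used, columns used") take at least `C(m,s)` distinct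
values — a pair `(a, b)` is attained only by permutations `π` with `a = b ∘ π`, which form at most
a coset of the set-wise stabiliser of `supp a` (`|·| = s!(m−s)!`), and `m! / (s!(m−s)!) = C(m,s)`.
Size S/M. [folklore; Mathlib `Finset.card_le_mul_card_image`, `Nat.choose_mul_factorial_mul_factorial`,
`Fintype.card_perm`; tree `LRPencil.supp`] -/
theorem stub_coverCount :
    ∀ (m s : ℕ) (lab : Equiv.Perm (Fin m) → (Fin m → ℕ)),
      (∀ π, (LRPencil.supp (lab π)).card = s) →
      m.choose s ≤ (Finset.univ.image fun π : Equiv.Perm (Fin m) => (lab π, lab π ∘ ⇑π.symm)).card :=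
  -- H2 LANDED (wave 1, p152940): Theorems/ProjectionStabilityOptStepStubCoverCount.lean
  Summit.ValiantsHypothesis.ValiantsHypothesis.Theorems.ProjectionStabilityOptStep.CoverCount.stub_coverCount

/-- **K2 — the two-sided-torus lower bound** (NEW; held by the lead; proved in
`work/k2/TwoSidedTorusLower.lean` from the landed H1, H2 and the toolkit files I, II): for `m ≥ 3`, every affine determinantal representation of `per_m` over `ℂ` that is
equivariant, with exact lifts `A(γ·x) = g A(x) h⁻¹`, for the two-sided torus
`{x ↦ diag(d) · x · diag(e)}` (as the subgroup of `GL(m²)` generated by the diagonal substitutions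
`X (i,j) ↦ d i * e j * X (i,j)` — verbatim the group of `Grenet.isEquivariantDetRepr_repr`) has size
`N ≥ 2^m − 1`.  With `Grenet.hasEquivariantDetRepr_perPoly_twoSidedTorus` this is
`edc_{T²}(per_m) = 2^m − 1`.  Proof: module docstring (regularity from von zur Gathen; LR §6 canonical
subspaces with one lifted generic torus element `diag(p) ⊗ diag(q)`; restricted pencils `A(y·P_π)`;
swap argument for the top exponent; chain; H2).  Size XL (≈ 900 lines, 3 files).
[LandsbergRessayre2017 §6 (method); vonzurGathen1987 Thm 3.1; new] -/
theorem stub_twoSidedTorus_lower :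
    ∀ m : ℕ, 3 ≤ m → ∀ (N : ℕ) (A : Matrix (Fin N) (Fin N) (MvPolynomial (Fin m × Fin m) ℂ)),
      IsEquivariantDetRepr
        (Subgroup.closure {γ : GL (Fin m × Fin m) ℂ | ∃ d e : Fin m → ℂ,
          (γ : Matrix (Fin m × Fin m) (Fin m × Fin m) ℂ) = Matrix.diagonal (fun p => d p.1 * e p.2)})
        (perPoly (Fin m) ℂ) A → 2 ^ m - 1 ≤ N :=
  -- K2 LANDED (lead c1, cycle 2, p155768): Theorems/ProjectionStabilityOptStepStubTwoSidedTorusLower.lean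
  Summit.ValiantsHypothesis.ValiantsHypothesis.Theorems.ProjectionStabilityOptStep.TwoSidedTorusLower.stub_twoSidedTorus_lower

/-- **THE BET (v3) — `Opt n ∧ Uniq n` produce symmetry at optimal size one level up**:
for `n ≥ 3`, if Grenet is optimal at level `n` and optimal projections of `per_n` are unique modulo
constant gauge × `permSymmetrySubst` × transposition (`Uniq n` verbatim), then SOME affine
determinantal representation of `per_{n+1}` of size exactly `pdc(per_{n+1})` is equivariant (exact
lifts) either for the left monomial symmetries `x ↦ g x` (patching card: glue the level-`n`
half-symmetries of the Laplace-restriction cores, S2–S6, S8) or for the two-sided torus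
(degeneration cards: a closed `S(GL × GL) × T²`-orbit in the closure of the optimal class).
By `symOrTorusStep_iff_optStep` below this is EQUIVALENT to the crux (given K2, LR, Grenet): it is
the crux's conclusion re-expressed as "symmetry at optimal size", and it is where `Opt n`/`Uniq n`
are consumed.  Size XL (research). -/
theorem stub_symOrTorusStep :
    ∀ n ≥ 3, 2 ^ n - 1 ≤ detProjectionComplexity (perPoly (Fin n) ℂ) →
      (∀ A B : Matrix (Fin (detProjectionComplexity (perPoly (Fin n) ℂ)))
          (Fin (detProjectionComplexity (perPoly (Fin n) ℂ))) (MvPolynomial (Fin n × Fin n) ℂ),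
        (∀ i j, (∃ v, A i j = MvPolynomial.X v) ∨ ∃ c, A i j = MvPolynomial.C c) →
        (∀ i j, (∃ v, B i j = MvPolynomial.X v) ∨ ∃ c, B i j = MvPolynomial.C c) →
        A.det = perPoly (Fin n) ℂ → B.det = perPoly (Fin n) ℂ →
        ∃ (P Q : GL (Fin (detProjectionComplexity (perPoly (Fin n) ℂ))) ℂ) (γ : GL (Fin n × Fin n) ℂ),
          γ ∈ permSymmetrySubst ℂ n ∧
          (B = (P : Matrix _ _ ℂ).map MvPolynomial.C * Matrix.linSubstEntries γ A * (Q : Matrix _ _ ℂ).map MvPolynomial.C ∨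
            B = (P : Matrix _ _ ℂ).map MvPolynomial.C * (Matrix.linSubstEntries γ A).transpose *
              (Q : Matrix _ _ ℂ).map MvPolynomial.C)) →
      ∃ B : Matrix (Fin (detProjectionComplexity (perPoly (Fin (n + 1)) ℂ)))
          (Fin (detProjectionComplexity (perPoly (Fin (n + 1)) ℂ))) (MvPolynomial (Fin (n + 1) × Fin (n + 1)) ℂ),
        IsEquivariantDetRepr (leftMonomialSubst ℂ (n + 1)) (perPoly (Fin (n + 1)) ℂ) B ∨
        IsEquivariantDetRepr
          (Subgroup.closure {γ : GL (Fin (n + 1) × Fin (n + 1)) ℂ | ∃ d e : Fin (n + 1) → ℂ,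
            (γ : Matrix (Fin (n + 1) × Fin (n + 1)) (Fin (n + 1) × Fin (n + 1)) ℂ) =
              Matrix.diagonal (fun p => d p.1 * e p.2)})
          (perPoly (Fin (n + 1)) ℂ) B := by
  sorry

/-! ## Consequences and the composition -/

/-- K2 (alias kept for the composition; H1, H2 enter through K2's proof file). -/
theorem twoSidedTorus_lower :
    ∀ m : ℕ, 3 ≤ m → ∀ (N : ℕ) (A : Matrix (Fin N) (Fin N) (MvPolynomial (Fin m × Fin m) ℂ)),
      IsEquivariantDetRepr
        (Subgroup.closure {γ : GL (Fin m × Fin m) ℂ | ∃ d e : Fin m → ℂ,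
          (γ : Matrix (Fin m × Fin m) (Fin m × Fin m) ℂ) = Matrix.diagonal (fun p => d p.1 * e p.2)})
        (perPoly (Fin m) ℂ) A → 2 ^ m - 1 ≤ N :=
  stub_twoSidedTorus_lower

/-- S2 ⇒ `pdc(per_n) ≤ 2ⁿ − 1` (`n ≥ 1`). -/
theorem pdc_le_grenet {n : ℕ} (hn : 1 ≤ n) :
    detProjectionComplexity (perPoly (Fin n) ℂ) ≤ 2 ^ n - 1 :=
  Nat.sInf_le (stub_grenetProjection n hn)

/-- S2 + `Opt n` ⇒ the optimal size IS Grenet's: `pdc(per_n) = 2ⁿ − 1`. -/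
theorem pdc_eq_of_opt {n : ℕ} (hn : 1 ≤ n)
    (hopt : 2 ^ n - 1 ≤ detProjectionComplexity (perPoly (Fin n) ℂ)) :
    detProjectionComplexity (perPoly (Fin n) ℂ) = 2 ^ n - 1 :=
  le_antisymm (pdc_le_grenet hn) hopt

/-- **The line concludes the crux BY NAME**: the bet gives a symmetric representation of size
`pdc(per_{n+1})`; LR17 Thm 2.8 (`lr_left_equivariant_lower_holds`, left-monomial case) or K2
(two-sided-torus case) bounds that size below by `2^(n+1) − 1`. -/
theorem OptStep_of :
    Summit.ValiantsHypothesis.ValiantsHypothesis.Theses.ProjectionStability.OptStep := by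
  intro n hn hopt huniq
  have h3 : 3 ≤ n + 1 := by omega
  obtain ⟨B, hB | hB⟩ := stub_symOrTorusStep n hn hopt huniq
  · exact lr_left_equivariant_lower_holds (n + 1) h3 _ B hB
  · exact twoSidedTorus_lower (n + 1) h3 _ B hB

/-! ## Honest scope: the bet is equivalent to the crux (given K2, LR17 Thm 2.8, Grenet) -/

/-- Grenet supplies, at EVERY level `k ≥ 1` with `Opt k`, a representation of size exactly
`pdc(per_k)` that is both left-monomial- (S3) and two-sided-torus-equivariant
(`Grenet.isEquivariantDetRepr_repr`). -/
theorem exists_symmetric_of_opt {k : ℕ} (hk : 1 ≤ k)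
    (hopt : 2 ^ k - 1 ≤ detProjectionComplexity (perPoly (Fin k) ℂ)) :
    ∃ B : Matrix (Fin (detProjectionComplexity (perPoly (Fin k) ℂ)))
        (Fin (detProjectionComplexity (perPoly (Fin k) ℂ))) (MvPolynomial (Fin k × Fin k) ℂ),
      IsEquivariantDetRepr (leftMonomialSubst ℂ k) (perPoly (Fin k) ℂ) B ∧
      IsEquivariantDetRepr
        (Subgroup.closure {γ : GL (Fin k × Fin k) ℂ | ∃ d e : Fin k → ℂ,
          (γ : Matrix (Fin k × Fin k) (Fin k × Fin k) ℂ) = Matrix.diagonal (fun p => d p.1 * e p.2)})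
        (perPoly (Fin k) ℂ) B := by
  have hk0 : k ≠ 0 := by omega
  have hpdc := pdc_eq_of_opt hk hopt
  -- generalise the size so that it becomes a variable equal to `N`, `2^k = N + 1`
  suffices key : ∀ M : ℕ, M = 2 ^ k - 1 →
      ∃ B : Matrix (Fin M) (Fin M) (MvPolynomial (Fin k × Fin k) ℂ),
        IsEquivariantDetRepr (leftMonomialSubst ℂ k) (perPoly (Fin k) ℂ) B ∧
        IsEquivariantDetRepr
          (Subgroup.closure {γ : GL (Fin k × Fin k) ℂ | ∃ d e : Fin k → ℂ,
            (γ : Matrix (Fin k × Fin k) (Fin k × Fin k) ℂ) = Matrix.diagonal (fun p => d p.1 * e p.2)})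
          (perPoly (Fin k) ℂ) B from key _ hpdc
  rintro M rfl
  have hN : 2 ^ k = (2 ^ k - 1) + 1 := by have := @Nat.one_le_two_pow k; omega
  have hcard : Fintype.card (Finset (Fin k)) = (2 ^ k - 1) + 1 := by
    rw [Fintype.card_finset, Fintype.card_fin]; exact hN
  obtain ⟨eqv⟩ : Nonempty (Finset (Fin k) ≃ Fin ((2 ^ k - 1) + 1)) := ⟨Fintype.equivFinOfCardEq hcard⟩
  exact ⟨Grenet.repr ℂ k eqv, stub_grenet_leftEquivariant k hk0 _ hN eqv,
    Grenet.isEquivariantDetRepr_repr hk0 hN eqv⟩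

/-- **The bet, level by level, is exactly the crux body**: for every `n ≥ 3`,
`(Opt n → Uniq n → ∃ symmetric optimal-size representation at n+1) ↔ (Opt n → Uniq n → Opt (n+1))`
(→: LR17 Thm 2.8 / K2; ←: Grenet at level `n+1`).  So a symmetry line can only RE-EXPRESS the
crux; the mechanism that produces the symmetry is the research content. -/
theorem symOrTorusStep_iff_optStep (n : ℕ) (hn : 3 ≤ n) :
    (2 ^ n - 1 ≤ detProjectionComplexity (perPoly (Fin n) ℂ) →
      (∀ A B : Matrix (Fin (detProjectionComplexity (perPoly (Fin n) ℂ)))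
          (Fin (detProjectionComplexity (perPoly (Fin n) ℂ))) (MvPolynomial (Fin n × Fin n) ℂ),
        (∀ i j, (∃ v, A i j = MvPolynomial.X v) ∨ ∃ c, A i j = MvPolynomial.C c) →
        (∀ i j, (∃ v, B i j = MvPolynomial.X v) ∨ ∃ c, B i j = MvPolynomial.C c) →
        A.det = perPoly (Fin n) ℂ → B.det = perPoly (Fin n) ℂ →
        ∃ (P Q : GL (Fin (detProjectionComplexity (perPoly (Fin n) ℂ))) ℂ) (γ : GL (Fin n × Fin n) ℂ),
          γ ∈ permSymmetrySubst ℂ n ∧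
          (B = (P : Matrix _ _ ℂ).map MvPolynomial.C * Matrix.linSubstEntries γ A * (Q : Matrix _ _ ℂ).map MvPolynomial.C ∨
            B = (P : Matrix _ _ ℂ).map MvPolynomial.C * (Matrix.linSubstEntries γ A).transpose *
              (Q : Matrix _ _ ℂ).map MvPolynomial.C)) →
      ∃ B : Matrix (Fin (detProjectionComplexity (perPoly (Fin (n + 1)) ℂ)))
          (Fin (detProjectionComplexity (perPoly (Fin (n + 1)) ℂ))) (MvPolynomial (Fin (n + 1) × Fin (n + 1)) ℂ),
        IsEquivariantDetRepr (leftMonomialSubst ℂ (n + 1)) (perPoly (Fin (n + 1)) ℂ) B ∨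
        IsEquivariantDetRepr
          (Subgroup.closure {γ : GL (Fin (n + 1) × Fin (n + 1)) ℂ | ∃ d e : Fin (n + 1) → ℂ,
            (γ : Matrix (Fin (n + 1) × Fin (n + 1)) (Fin (n + 1) × Fin (n + 1)) ℂ) =
              Matrix.diagonal (fun p => d p.1 * e p.2)})
          (perPoly (Fin (n + 1)) ℂ) B) ↔
    (2 ^ n - 1 ≤ detProjectionComplexity (perPoly (Fin n) ℂ) →
      (∀ A B : Matrix (Fin (detProjectionComplexity (perPoly (Fin n) ℂ)))
          (Fin (detProjectionComplexity (perPoly (Fin n) ℂ))) (MvPolynomial (Fin n × Fin n) ℂ),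
        (∀ i j, (∃ v, A i j = MvPolynomial.X v) ∨ ∃ c, A i j = MvPolynomial.C c) →
        (∀ i j, (∃ v, B i j = MvPolynomial.X v) ∨ ∃ c, B i j = MvPolynomial.C c) →
        A.det = perPoly (Fin n) ℂ → B.det = perPoly (Fin n) ℂ →
        ∃ (P Q : GL (Fin (detProjectionComplexity (perPoly (Fin n) ℂ))) ℂ) (γ : GL (Fin n × Fin n) ℂ),
          γ ∈ permSymmetrySubst ℂ n ∧
          (B = (P : Matrix _ _ ℂ).map MvPolynomial.C * Matrix.linSubstEntries γ A * (Q : Matrix _ _ ℂ).map MvPolynomial.C ∨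
            B = (P : Matrix _ _ ℂ).map MvPolynomial.C * (Matrix.linSubstEntries γ A).transpose *
              (Q : Matrix _ _ ℂ).map MvPolynomial.C)) →
      2 ^ (n + 1) - 1 ≤ detProjectionComplexity (perPoly (Fin (n + 1)) ℂ)) := by
  have h3 : 3 ≤ n + 1 := by omega
  constructor
  · intro h hopt huniq
    obtain ⟨B, hB | hB⟩ := h hopt huniq
    · exact lr_left_equivariant_lower_holds (n + 1) h3 _ B hB
    · exact twoSidedTorus_lower (n + 1) h3 _ B hB
  · intro h hopt huniq
    obtain ⟨B, hl, ht⟩ := exists_symmetric_of_opt (k := n + 1) (by omega) (h hopt huniq)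
    exact ⟨B, Or.inl hl⟩

end

end Summit.ValiantsHypothesis.ValiantsHypothesis.Cruxes.OptStep.Sketch
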